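import Literature.Computability.QuantumComplexity.GluedTreesThm9Master
import Literature.Computability.QuantumComplexity.GluedTreesThm9EmbGeom
import Literature.Computability.QuantumComplexity.GluedTreesThm9EmbProb
import Mathlib.Analysis.SpecialFunctions.Pow.Real
import HarnessLib
/-!
# Glued trees, Theorem 9 (classical lower bound) — XVII: the final count

Theorem-only file closing the proof of `ChildsEtAl2003_thm9` (Childs–Cleve–Deotto–Farhi–Gutmann–
Spielman 2003, Theorem 9): any classical algorithm making `t ≤ 2^(n/6)` queries to the glued-trees
oracle finds the EXIT with probability at most `4 · 2^(-n/6)`.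

* `card_improper_le`: by the rigorous Lemma 8 (`proper_of_good`) an improper embedding is deep,
  or triggers a spread or a block event; the three counts (`card_deep_le`,
  `card_badSpread_mul_le`, `card_badBlock_mul_le`) bound the number `B` of improper pairs
  (coins, cycle);
* `findProb_le_terms`: the MASTER inequality (`findProb_le_of_improper_bound`, Games 1–5 and
  Lemma 7) then bounds the success probability by four explicit terms;
* `terms_mono`, `terms_le_generic`: elementary real arithmetic with the height parameter
  `h = ⌊5n/12⌋` (for `n ≥ 18`; the cases `13 ≤ n ≤ 17` are evaluated numerically and `n ≤ 12` is
  trivial), giving `ChildsEtAl2003_thm9_holds`.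

## References

* [ChildsEtAl2003] A. M. Childs, R. Cleve, E. Deotto, E. Farhi, S. Gutmann, D. A. Spielman,
  Exponential algorithmic speedup by a quantum walk, STOC 2003, §4, Theorem 9 (with Lemmas 7, 8).
-/

open Literature.Computability.Complexity

namespace Literature.Computability.QuantumComplexity

namespace GluedTrees

open Finset

open scoped Classical

variable {n : ℕ}

/-! ### Few expansions cannot climb high -/

/-- The up-count of node `m` is at most the number of expansions before its creation plus one.
[cite: ChildsEtAl2003, §4 (Lemma 8 (i))] -/
theorem upCount_le (σ : CycleDatum n) {par : List ℕ} (hval : ∀ i (h : i < par.length), par[i] ≤ 2 * i)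
    (c : ℕ → Bool) : ∀ m ≤ 2 * par.length, upCount σ par c m ≤ (m + 1) / 2 := by
  intro m
  induction m using Nat.strong_induction_on with
  | _ m ih =>
    intro hm
    rcases Nat.eq_zero_or_pos m with rfl | hm1
    · simp
    · by_cases hu : IsUp σ par c m
      · obtain ⟨hpeq, hlt⟩ := parentOf_lt hval hm1 hm
        have hpar : parentOf par m ≤ 2 * ((m - 1) / 2) := by rw [hpeq]; exact hval _ _
        have := ih (parentOf par m) (by omega) (by omega)
        rw [upCount_eq_succ σ hval c hm hu]
        omega
      · rw [upCount_eq_zero σ hval c hm hu]; omega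

/-- With fewer than `h` expansions the embedding is never deep. [cite: ChildsEtAl2003, §4 (Lemma 8 (i))] -/
theorem not_deep_of_length_lt (σ : CycleDatum n) {par : List ℕ} (hval : ∀ i (h : i < par.length), par[i] ≤ 2 * i)
    (c : ℕ → Bool) {h : ℕ} (hlt : par.length < h) : ¬ Deep σ par c h := by
  rintro ⟨m, hm, hmc⟩
  have := upCount_le σ hval c m hm
  omega

/-- **The deep embeddings are few**, multiplicative form valid for every `h`.
[cite: ChildsEtAl2003, §4 (Lemma 8 (i))] -/
theorem card_deep_mul_le {par : List ℕ} (hval : ∀ i (h : i < par.length), par[i] ≤ 2 * i) {t : ℕ}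
    (ht : par.length ≤ t) (h : ℕ) :
    (Finset.univ.filter fun cσ : (Fin t → Bool) × CycleDatum n ↦
      Deep cσ.2 par (fun i ↦ if hi : i < t then cσ.1 ⟨i, hi⟩ else false) h).card * 2 ^ h ≤
      (2 * t + 1) * 2 ^ t * Fintype.card (CycleDatum n) := by
  by_cases hht : h ≤ t
  · calc _ ≤ (2 * par.length + 1) * 2 ^ (t - h) * Fintype.card (CycleDatum n) * 2 ^ h :=
          Nat.mul_le_mul_right _ (card_deep_le hval ht h)
      _ = (2 * par.length + 1) * (2 ^ (t - h) * 2 ^ h) * Fintype.card (CycleDatum n) := by ring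
      _ = (2 * par.length + 1) * 2 ^ t * Fintype.card (CycleDatum n) := by
          rw [← pow_add, Nat.sub_add_cancel hht]
      _ ≤ (2 * t + 1) * 2 ^ t * Fintype.card (CycleDatum n) := by gcongr
  · have hemp : (Finset.univ.filter fun cσ : (Fin t → Bool) × CycleDatum n ↦
        Deep cσ.2 par (fun i ↦ if hi : i < t then cσ.1 ⟨i, hi⟩ else false) h) = ∅ := by
      refine Finset.filter_eq_empty_iff.mpr ?_
      intro cσ _
      exact not_deep_of_length_lt cσ.2 hval _ (by omega)
    rw [hemp, Finset.card_empty, zero_mul]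
    exact Nat.zero_le _

/-! ### The improper embeddings are few -/

/-- **Rigorous Lemma 8, counted.** The number `B` of pairs (coins, cycle) whose embedding is not
proper. [cite: ChildsEtAl2003, §4 (Lemma 8)] -/
theorem card_improper_le (hn : 1 ≤ n) {par : List ℕ} (hval : ValidPar par) {t h : ℕ} (ht : par.length ≤ t)
    (hN : 4 * t + 10 ≤ 2 ^ n) (h2 : 2 ≤ h) (hh : h ≤ n) :
    (Finset.univ.filter fun cσ : (Fin t → Bool) × CycleDatum n ↦
      ¬ Proper cσ.2 par (fun i ↦ if hi : i < t then cσ.1 ⟨i, hi⟩ else false)).card ≤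
      (2 * t + 1) * 2 ^ t * Fintype.card (CycleDatum n) / 2 ^ h +
      t * (3 * t * (4 * t + 9)) * 2 ^ t * Fintype.card (CycleDatum n) / (2 ^ n - (3 * t + 1)) +
      t * ((8 * t + 5) * 2 ^ (h - 1)) * 2 ^ t * Fintype.card (CycleDatum n) / (2 ^ n - (3 * t + 2)) := by
  have hD1 : 0 < 2 ^ n - (3 * t + 1) := by omega
  have hD2 : 0 < 2 ^ n - (3 * t + 2) := by omega
  have hcover : (Finset.univ.filter fun cσ : (Fin t → Bool) × CycleDatum n ↦
      ¬ Proper cσ.2 par (fun i ↦ if hi : i < t then cσ.1 ⟨i, hi⟩ else false)) ⊆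
      (Finset.univ.filter fun cσ : (Fin t → Bool) × CycleDatum n ↦
        Deep cσ.2 par (fun i ↦ if hi : i < t then cσ.1 ⟨i, hi⟩ else false) h) ∪
      (Finset.univ.filter fun cσ : (Fin t → Bool) × CycleDatum n ↦
        ∃ j < par.length, BadSpread cσ.2 par (fun i ↦ if hi : i < t then cσ.1 ⟨i, hi⟩ else false) t j) ∪
      (Finset.univ.filter fun cσ : (Fin t → Bool) × CycleDatum n ↦
        ∃ j < par.length, BadBlock cσ.2 par (fun i ↦ if hi : i < t then cσ.1 ⟨i, hi⟩ else false) h j) := by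
    intro cσ hcσ
    rw [Finset.mem_filter] at hcσ
    by_contra hno
    simp only [Finset.mem_union, Finset.mem_filter, Finset.mem_univ, true_and, not_or, not_exists,
      not_and] at hno
    obtain ⟨⟨hd, hs⟩, hb⟩ := hno
    exact hcσ.2 (proper_of_good hn cσ.2 hval _ ht hN h2 hh hd fun j hj ↦ ⟨hs j hj, hb j hj⟩)
  refine (Finset.card_le_card hcover).trans ?_
  refine (Finset.card_union_le _ _).trans ?_
  refine (Nat.add_le_add_right (Finset.card_union_le _ _) _).trans ?_
  refine Nat.add_le_add (Nat.add_le_add ?_ ?_) ?_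
  · exact (Nat.le_div_iff_mul_le (by positivity)).mpr (card_deep_mul_le hval.2 ht h)
  · refine (Nat.le_div_iff_mul_le hD1).mpr ?_
    refine (card_badSpread_mul_le hn hval.2 ht).trans ?_
    gcongr
  · refine (Nat.le_div_iff_mul_le hD2).mpr ?_
    refine (card_badBlock_mul_le hn hval.2 ht (by omega : h ≤ n + 1)).trans ?_
    gcongr

/-- **The success probability is bounded by four explicit terms** (guessing, deep embeddings,
spread events, block events). [cite: ChildsEtAl2003, §4 (Theorem 9)] -/
theorem findProb_le_terms (hn : 1 ≤ n) {β : Type} (M : OracleAlg β) (x : List Bool) {t h : ℕ}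
    (hN : 4 * t + 10 ≤ 2 ^ n) (h2 : 2 ≤ h) (hh : h ≤ n) :
    findProb n M x t ≤ (t : ℝ) * (4 * 2 ^ n) / (4 ^ n - (3 * t + 1)) + (2 * t + 1) / 2 ^ h +
      t * (3 * t * (4 * t + 9)) / (2 ^ n - (3 * t + 1)) + t * ((8 * t + 5) * 2 ^ (h - 1)) / (2 ^ n - (3 * t + 2)) := by
  have h4n : 2 ^ n ≤ 4 ^ n := Nat.pow_le_pow_left (by norm_num) n
  have h3t : 3 * t + 1 < 4 ^ n := by omega
  have main := findProb_le_of_improper_bound hn M x t h3t _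
    (fun par hval hlen ↦ card_improper_le hn hval hlen hN h2 hh)
  refine main.trans ?_
  have hSpos : 0 < Fintype.card (CycleDatum n) := Fintype.card_pos
  have hSR : (0 : ℝ) < Fintype.card (CycleDatum n) := by exact_mod_cast hSpos
  have hD0 : (0 : ℝ) < 4 ^ n - (3 * t + 1) := by
    have : ((3 * t + 1 : ℕ) : ℝ) < ((4 ^ n : ℕ) : ℝ) := by exact_mod_cast h3t
    push_cast at this; linarith
  have hD1n : 3 * t + 1 ≤ 2 ^ n := by omega
  have hD2n : 3 * t + 2 ≤ 2 ^ n := by omega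
  have hD1 : (0 : ℝ) < 2 ^ n - (3 * t + 1) := by
    have : ((3 * t + 1 : ℕ) : ℝ) < ((2 ^ n : ℕ) : ℝ) := by exact_mod_cast (show 3 * t + 1 < 2 ^ n by omega)
    push_cast at this; linarith
  have hD2 : (0 : ℝ) < 2 ^ n - (3 * t + 2) := by
    have : ((3 * t + 2 : ℕ) : ℝ) < ((2 ^ n : ℕ) : ℝ) := by exact_mod_cast (show 3 * t + 2 < 2 ^ n by omega)
    push_cast at this; linarith
  -- guessing term: `|V| ≤ 4 · 2^n`
  have hV : (Fintype.card (Vertex n) : ℝ) ≤ 4 * 2 ^ n := by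
    rw [card_vertex]
    have : 2 ^ (n + 2) - 2 ≤ 4 * 2 ^ n :=
      calc 2 ^ (n + 2) - 2 ≤ 2 ^ (n + 2) := Nat.sub_le _ _
        _ = 4 * 2 ^ n := by ring
    exact_mod_cast this
  have hT1 : (t : ℝ) * (Fintype.card (Vertex n) : ℝ) / (4 ^ n - (3 * t + 1)) ≤
      (t : ℝ) * (4 * 2 ^ n) / (4 ^ n - (3 * t + 1)) :=
    div_le_div_of_nonneg_right (mul_le_mul_of_nonneg_left hV (Nat.cast_nonneg t)) hD0.le
  -- the three counted terms
  have hB : (((2 * t + 1) * 2 ^ t * Fintype.card (CycleDatum n) / 2 ^ h +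
      t * (3 * t * (4 * t + 9)) * 2 ^ t * Fintype.card (CycleDatum n) / (2 ^ n - (3 * t + 1)) +
      t * ((8 * t + 5) * 2 ^ (h - 1)) * 2 ^ t * Fintype.card (CycleDatum n) / (2 ^ n - (3 * t + 2)) : ℕ) : ℝ) /
        (2 ^ t * Fintype.card (CycleDatum n)) ≤
      (2 * t + 1) / 2 ^ h + t * (3 * t * (4 * t + 9)) / (2 ^ n - (3 * t + 1)) +
        t * ((8 * t + 5) * 2 ^ (h - 1)) / (2 ^ n - (3 * t + 2)) := by
    have hP : (0 : ℝ) < 2 ^ t * Fintype.card (CycleDatum n) := by positivity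
    rw [Nat.cast_add, Nat.cast_add, add_div, add_div]
    refine add_le_add (add_le_add ?_ ?_) ?_
    · calc _ ≤ ((2 * t + 1 : ℝ) * (2 ^ t * Fintype.card (CycleDatum n)) / 2 ^ h) /
            (2 ^ t * Fintype.card (CycleDatum n)) := by
            apply div_le_div_of_nonneg_right _ hP.le
            refine Nat.cast_div_le.trans_eq ?_
            push_cast; ring
        _ = (2 * t + 1) / 2 ^ h := by rw [div_div, mul_div_mul_right _ _ hP.ne']
    · calc _ ≤ ((t : ℝ) * (3 * t * (4 * t + 9)) * (2 ^ t * Fintype.card (CycleDatum n)) / (2 ^ n - (3 * t + 1))) /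
            (2 ^ t * Fintype.card (CycleDatum n)) := by
            apply div_le_div_of_nonneg_right _ hP.le
            refine Nat.cast_div_le.trans_eq ?_
            push_cast [Nat.cast_sub hD1n]; ring
        _ = t * (3 * t * (4 * t + 9)) / (2 ^ n - (3 * t + 1)) := by rw [div_div, mul_div_mul_right _ _ hP.ne']
    · calc _ ≤ ((t : ℝ) * ((8 * t + 5) * 2 ^ (h - 1)) * (2 ^ t * Fintype.card (CycleDatum n)) / (2 ^ n - (3 * t + 2))) /
            (2 ^ t * Fintype.card (CycleDatum n)) := by
            apply div_le_div_of_nonneg_right _ hP.le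
            refine Nat.cast_div_le.trans_eq ?_
            push_cast [Nat.cast_sub hD2n]; ring
        _ = t * ((8 * t + 5) * 2 ^ (h - 1)) / (2 ^ n - (3 * t + 2)) := by
            rw [div_div, mul_div_mul_right _ _ hP.ne']
  linarith

/-! ### Real arithmetic -/

/-- The four terms are monotone in the number of queries. [cite: ChildsEtAl2003, §4 (Theorem 9)] -/
theorem terms_mono {t T A N H H' : ℝ} (ht0 : 0 ≤ t) (htT : t ≤ T) (hA : 3 * T + 1 < A) (hN : 3 * T + 2 < N)
    (hN0 : 0 ≤ N) (hH : 0 < H) (hH' : 0 ≤ H') :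
    t * (4 * N) / (A - (3 * t + 1)) + (2 * t + 1) / H + t * (3 * t * (4 * t + 9)) / (N - (3 * t + 1)) +
        t * ((8 * t + 5) * H') / (N - (3 * t + 2)) ≤
      T * (4 * N) / (A - (3 * T + 1)) + (2 * T + 1) / H + T * (3 * T * (4 * T + 9)) / (N - (3 * T + 1)) +
        T * ((8 * T + 5) * H') / (N - (3 * T + 2)) := by
  have hT0 : 0 ≤ T := ht0.trans htT
  have htt : t * t ≤ T * T := mul_le_mul htT htT ht0 hT0
  have httt : t * t * t ≤ T * T * T := mul_le_mul htt htT ht0 (by positivity)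
  have httH : t * t * H' ≤ T * T * H' := mul_le_mul_of_nonneg_right htt hH'
  have htH : t * H' ≤ T * H' := mul_le_mul_of_nonneg_right htT hH'
  have htN : t * N ≤ T * N := mul_le_mul_of_nonneg_right htT hN0
  refine add_le_add (add_le_add (add_le_add ?_ ?_) ?_) ?_
  · exact div_le_div₀ (by positivity) (by linarith) (by linarith) (by linarith)
  · exact div_le_div_of_nonneg_right (by linarith) hH.le
  · exact div_le_div₀ (by positivity) (by linarith) (by linarith) (by linarith)
  · exact div_le_div₀ (by positivity) (by linarith) (by linarith) (by linarith)

/-- **The four terms are at most `4 / r²`** for `r = 2^(n/12) ≥ 2.82` (that is `n ≥ 18`), `t ≤ r²`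
queries, and `2^h` within a factor `2` below `r⁵`. [cite: ChildsEtAl2003, §4 (Theorem 9)] -/
theorem terms_le_generic {r t H H' : ℝ} (hr : (141 / 50 : ℝ) ≤ r) (ht0 : 0 ≤ t) (ht : t ≤ r ^ 2)
    (hH : 0 < H) (hHlo : r ^ 5 ≤ 2 * H) (hH'0 : 0 ≤ H') (hH'hi : 2 * H' ≤ r ^ 5) :
    t * (4 * r ^ 12) / (r ^ 24 - (3 * t + 1)) + (2 * t + 1) / H + t * (3 * t * (4 * t + 9)) / (r ^ 12 - (3 * t + 1)) +
        t * ((8 * t + 5) * H') / (r ^ 12 - (3 * t + 2)) ≤ 4 / r ^ 2 := by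
  have hr0 : 0 < r := by linarith
  have step : ∀ k : ℕ, (141 / 50 : ℝ) * r ^ k ≤ r ^ (k + 1) := fun k ↦ by
    rw [pow_succ]
    have := mul_le_mul_of_nonneg_left hr (pow_nonneg hr0.le k)
    linarith
  have s1 : (141 / 50 : ℝ) * r ^ 1 ≤ r ^ 2 := step 1
  have s2 : (141 / 50 : ℝ) * r ^ 2 ≤ r ^ 3 := step 2
  have s3 : (141 / 50 : ℝ) * r ^ 3 ≤ r ^ 4 := step 3
  have s4 : (141 / 50 : ℝ) * r ^ 4 ≤ r ^ 5 := step 4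
  have s5 : (141 / 50 : ℝ) * r ^ 5 ≤ r ^ 6 := step 5
  have s6 : (141 / 50 : ℝ) * r ^ 6 ≤ r ^ 7 := step 6
  have s7 : (141 / 50 : ℝ) * r ^ 7 ≤ r ^ 8 := step 7
  have s8 : (141 / 50 : ℝ) * r ^ 8 ≤ r ^ 9 := step 8
  have s9 : (141 / 50 : ℝ) * r ^ 9 ≤ r ^ 10 := step 9
  have s10 : (141 / 50 : ℝ) * r ^ 10 ≤ r ^ 11 := step 10
  have s11 : (141 / 50 : ℝ) * r ^ 11 ≤ r ^ 12 := step 11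
  rw [pow_one] at s1
  have h2 : (159 / 20 : ℝ) ≤ r ^ 2 := by nlinarith
  have h8 : (3000 : ℝ) ≤ r ^ 8 := by linarith
  have h16 : r ^ 2 ≤ r ^ 16 := pow_le_pow_right₀ (by linarith) (by norm_num)
  have h24 : 3000 * r ^ 16 ≤ r ^ 24 := by
    have := mul_le_mul_of_nonneg_left h8 (pow_nonneg hr0.le 16)
    rw [← pow_add] at this
    norm_num at this
    linarith
  have h12 : 3 * r ^ 2 + 2 < r ^ 12 := by linarith
  have hA : 3 * r ^ 2 + 1 < r ^ 24 := by linarith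
  refine (terms_mono ht0 ht hA h12 (by positivity) hH hH'0).trans ?_
  have hD24 : 0 < r ^ 24 - (3 * r ^ 2 + 1) := by linarith
  have hD12a : 0 < r ^ 12 - (3 * r ^ 2 + 1) := by linarith
  have hD12b : 0 < r ^ 12 - (3 * r ^ 2 + 2) := by linarith
  have hr2 : 0 < r ^ 2 := by positivity
  have hT1 : r ^ 2 * (4 * r ^ 12) / (r ^ 24 - (3 * r ^ 2 + 1)) ≤ (1 / 20) / r ^ 2 := by
    rw [div_le_div_iff₀ hD24 hr2]
    linarith
  have hT2 : (2 * r ^ 2 + 1) / H ≤ (17 / 10) / r ^ 2 := by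
    rw [div_le_div_iff₀ hH hr2]
    linarith
  have hT3 : r ^ 2 * (3 * r ^ 2 * (4 * r ^ 2 + 9)) / (r ^ 12 - (3 * r ^ 2 + 1)) ≤ (1 / 2) / r ^ 2 := by
    rw [div_le_div_iff₀ hD12a hr2]
    linarith
  have hT4 : r ^ 2 * ((8 * r ^ 2 + 5) * H') / (r ^ 12 - (3 * r ^ 2 + 2)) ≤ (7 / 4) / r ^ 2 := by
    rw [div_le_div_iff₀ hD12b hr2]
    have e1 := mul_le_mul_of_nonneg_left hH'hi (pow_nonneg hr0.le 6)
    have e2 := mul_le_mul_of_nonneg_left hH'hi (pow_nonneg hr0.le 4)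
    linarith
  calc _ ≤ (1 / 20) / r ^ 2 + (17 / 10) / r ^ 2 + (1 / 2) / r ^ 2 + (7 / 4) / r ^ 2 :=
      add_le_add (add_le_add (add_le_add hT1 hT2) hT3) hT4
    _ = 4 / r ^ 2 := by ring

end GluedTrees

/-! ### Theorem 9 -/

open GluedTrees in
/-- **Theorem 9 of Childs et al. (2003), proved**: a classical algorithm making at most `2^(n/6)`
queries to the glued-trees oracle finds the EXIT with probability at most `4 · 2^(-n/6)`.
[cite: ChildsEtAl2003, §4 (Theorem 9)] -/
theorem ChildsEtAl2003_thm9_holds : ChildsEtAl2003_thm9 := by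
  intro n β M x t hts
  -- the trivial range `n ≤ 12`, where the bound exceeds `1`
  by_cases hn12 : n ≤ 12
  · refine (findProb_le_one n M x t).trans ?_
    rw [Real.rpow_neg (by norm_num), ← div_eq_mul_inv, le_div_iff₀ (Real.rpow_pos_of_pos (by norm_num) _),
      one_mul]
    calc (2 : ℝ) ^ ((n : ℝ) / 6) ≤ (2 : ℝ) ^ (2 : ℝ) := by
          apply Real.rpow_le_rpow_of_exponent_le (by norm_num)
          have : (n : ℝ) ≤ 12 := by exact_mod_cast hn12
          linarith
      _ = 4 := by rw [Real.rpow_two]; norm_num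
  have hn13 : 13 ≤ n := by omega
  have hn1 : 1 ≤ n := by omega
  -- the parameter `r = 2^(n/12)`
  obtain ⟨r, hrdef⟩ : ∃ r : ℝ, r = (2 : ℝ) ^ ((n : ℝ) / 12) := ⟨_, rfl⟩
  have hr0 : 0 < r := by rw [hrdef]; exact Real.rpow_pos_of_pos (by norm_num) _
  have hrpow : ∀ k : ℕ, r ^ k = (2 : ℝ) ^ ((n : ℝ) / 12 * k) := fun k ↦ by
    rw [hrdef, ← Real.rpow_natCast, ← Real.rpow_mul (by norm_num)]
  have hr12 : r ^ 12 = (2 : ℝ) ^ n := by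
    rw [hrpow, show (n : ℝ) / 12 * ((12 : ℕ) : ℝ) = ((n : ℕ) : ℝ) by push_cast; ring, Real.rpow_natCast]
  have hr2 : r ^ 2 = (2 : ℝ) ^ ((n : ℝ) / 6) := by
    rw [hrpow]; congr 1; push_cast; ring
  have hts' : (t : ℝ) ≤ r ^ 2 := hr2 ▸ hts
  have ht6 : t ^ 6 ≤ 2 ^ n := by
    have h1 : ((t : ℝ)) ^ 6 ≤ (r ^ 2) ^ 6 := pow_le_pow_left₀ (Nat.cast_nonneg t) hts' 6
    rw [← pow_mul, show 2 * 6 = 12 by rfl, hr12] at h1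
    exact_mod_cast h1
  have htarget : (4 : ℝ) * 2 ^ (-((n : ℝ) / 6)) = 4 / r ^ 2 := by
    rw [Real.rpow_neg (by norm_num), ← hr2, div_eq_mul_inv]
  rw [htarget]
  -- integer side conditions and the height parameter
  have hN : 4 * t + 10 ≤ 2 ^ n := by
    by_cases ht4 : t ≤ 4
    · calc 4 * t + 10 ≤ 2 ^ 13 := by omega
        _ ≤ 2 ^ n := Nat.pow_le_pow_right (by norm_num) hn13
    · have ht5 : 5 ≤ t := by omega
      calc 4 * t + 10 ≤ t * t * t := by nlinarith
        _ = t ^ 3 := by ring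
        _ ≤ t ^ 6 := Nat.pow_le_pow_right (by omega) (by norm_num)
        _ ≤ 2 ^ n := ht6
  obtain ⟨h, hhdef⟩ : ∃ h : ℕ, h = 5 * n / 12 := ⟨_, rfl⟩
  have hh2 : 2 ≤ h := by omega
  have hhn : h ≤ n := by omega
  refine (findProb_le_terms hn1 M x hN hh2 hhn).trans ?_
  by_cases hn18 : 18 ≤ n
  · -- the generic range
    have hr : (141 / 50 : ℝ) ≤ r := by
      apply le_of_pow_le_pow_left₀ (by norm_num : (12 : ℕ) ≠ 0) hr0.le
      rw [hr12]
      calc (141 / 50 : ℝ) ^ 12 ≤ 2 ^ 18 := by norm_num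
        _ ≤ 2 ^ n := pow_le_pow_right₀ (by norm_num) hn18
    have hH : (0 : ℝ) < 2 ^ h := by positivity
    have hHlo : r ^ 5 ≤ 2 * (2 : ℝ) ^ h := by
      rw [hrpow, show (2 : ℝ) * 2 ^ h = 2 ^ (h + 1) by ring, ← Real.rpow_natCast 2 (h + 1)]
      apply Real.rpow_le_rpow_of_exponent_le (by norm_num)
      have e1 : 5 * n < 12 * h + 12 := by omega
      have e2 : ((5 * n : ℕ) : ℝ) < ((12 * h + 12 : ℕ) : ℝ) := by exact_mod_cast e1
      push_cast at e2 ⊢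
      linarith
    have hH'hi : 2 * (2 : ℝ) ^ (h - 1) ≤ r ^ 5 := by
      rw [← pow_succ', Nat.sub_add_cancel (by omega : 1 ≤ h), hrpow, ← Real.rpow_natCast 2 h]
      apply Real.rpow_le_rpow_of_exponent_le (by norm_num)
      have e1 : 12 * h ≤ 5 * n := by omega
      have e2 : ((12 * h : ℕ) : ℝ) ≤ ((5 * n : ℕ) : ℝ) := by exact_mod_cast e1
      push_cast at e2 ⊢
      linarith
    have h4n : (4 : ℝ) ^ n = r ^ 24 := by
      rw [show (4 : ℝ) = 2 ^ 2 by norm_num, ← pow_mul, show 2 * n = n * 2 by ring, pow_mul, ← hr12, ← pow_mul]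
    rw [h4n, ← hr12]
    exact terms_le_generic hr (Nat.cast_nonneg t) hts' hH hHlo (by positivity) hH'hi
  · -- the numerical range `13 ≤ n ≤ 17`
    have hn17 : n ≤ 17 := by omega
    have htar : ∀ c : ℝ, 0 ≤ c → c ^ 6 * 2 ^ n ≤ 4 ^ 6 → c ≤ 4 / r ^ 2 := by
      intro c hc h6
      rw [le_div_iff₀ (by positivity)]
      apply le_of_pow_le_pow_left₀ (by norm_num : (6 : ℕ) ≠ 0) (by norm_num)
      rw [mul_pow, ← pow_mul, show 2 * 6 = 12 by rfl, hr12]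
      exact h6
    have hTle : ∀ T : ℕ, 2 ^ n < (T + 1) ^ 6 → (t : ℝ) ≤ T := by
      intro T hT
      have : t ≤ T := by
        by_contra hlt
        have : (T + 1) ^ 6 ≤ t ^ 6 := Nat.pow_le_pow_left (by omega) 6
        omega
      exact_mod_cast this
    have hH : (0 : ℝ) < 2 ^ h := by positivity
    have hH' : (0 : ℝ) ≤ 2 ^ (h - 1) := by positivity
    clear hts hts' hr2 htarget hrpow hrdef
    interval_cases n
    · subst hhdef
      refine (terms_mono (Nat.cast_nonneg t) (hTle 4 (by norm_num)) (by norm_num) (by norm_num) (by norm_num)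
        hH hH').trans (le_trans ?_ (htar (3 / 4) (by norm_num) (by norm_num)))
      norm_num
    · subst hhdef
      refine (terms_mono (Nat.cast_nonneg t) (hTle 5 (by norm_num)) (by norm_num) (by norm_num) (by norm_num)
        hH hH').trans (le_trans ?_ (htar (3 / 4) (by norm_num) (by norm_num)))
      norm_num
    · subst hhdef
      refine (terms_mono (Nat.cast_nonneg t) (hTle 5 (by norm_num)) (by norm_num) (by norm_num) (by norm_num)
        hH hH').trans (le_trans ?_ (htar (1 / 2) (by norm_num) (by norm_num)))
      norm_num
    · subst hhdef
      refine (terms_mono (Nat.cast_nonneg t) (hTle 6 (by norm_num)) (by norm_num) (by norm_num) (by norm_num)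
        hH hH').trans (le_trans ?_ (htar (1 / 2) (by norm_num) (by norm_num)))
      norm_num
    · subst hhdef
      refine (terms_mono (Nat.cast_nonneg t) (hTle 7 (by norm_num)) (by norm_num) (by norm_num) (by norm_num)
        hH hH').trans (le_trans ?_ (htar (1 / 2) (by norm_num) (by norm_num)))
      norm_num

end Literature.Computability.QuantumComplexity
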